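import Summits.HodgeConjecture.HodgeConjecture.Theorems.MarkmanPartnerTransportPartnerTransportPicardRank
import Literature.AlgebraicGeometry.Hyperkaehler.K3HilbertTypeHodgeIsometryLift
import Literature.AlgebraicGeometry.HodgeTheory.HodgeModelExistence

/-!
# Route MarkmanPartnerTransport · support `PartnerTransport` (stmt-HodgeConjecture-19650) —
# Beauville's marked incidence `i = [θ]_* : H²(S) ↪ H²(S^{[2]})` and its retraction `π`

For a marked projective K3 surface `(S, η, p, x)`, a smooth projective fourfold `H` marked by `(φ_H, P_H)`
with period `(x, 0)`, and an algebraic class `θ` on `H × S` whose action is the marked inclusion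
`φ_H([θ]_* a) = (η a, 0)` (the output of `Beauville1983_hilbertSquare_markedIncidence`), with
`π := η⁻¹ ∘ pr_{Λ_{K3}} ∘ φ_H : H²(H) → H²(S)`:

* `incidence_injective`, `isRationalClass_incidence`, `incidence_twoZero`, `incidence_oneOne` — `i` is
  injective, rational and carries `(2,0)`/`(1,1)`-classes to `(2,0)`/`(1,1)`-classes;
* `retraction_incidence`, `isRationalClass_retraction`, `retraction_twoZero`, `retraction_oneOne`,
  `retraction_mem_algebraicClasses` — `π ∘ i = id`, `π` is rational, carries `(2,0)`/`(1,1)`-classes to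
  `(2,0)`/`(1,1)`-classes, and maps `N¹(H)` into `N¹(S)` (Lefschetz `(1,1)` on `S`);
* `incidence_bbfTransc` — `i` carries cup-transcendental classes of `S` to `q`-transcendental classes of
  `H` (`[θ]_* N¹(S) ⊆ N¹(H)` is not even needed: `q((η t, 0), φ_H w) = (η t · η(π w))`).

No definition, no sorry, no named fact (the multiplicativity fact enters only through the hypothesis shape
of `corrAction`, not at all here). Prover seat hodge-nonav-19652-p1 (gen 6), `--supports stmt-HodgeConjecture-19650`.

References: A. Beauville, J. Differential Geom. 18 (1983) §6 Prop. 6 and Remarque, §9 Lemme 1;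
D. Huybrechts, *Lectures on K3 Surfaces* Ch. 3 §2–3; C. Voisin, *Hodge Theory I* Thm. 11.30.
-/

noncomputable section

set_option linter.dupNamespace false

open scoped Matrix
open Module CategoryTheory MonoidalCategory
open Literature.AlgebraicTopology.SingularHomology Literature.Geometry.Kaehler
open Literature.AlgebraicGeometry Literature.AlgebraicGeometry.Motives Literature.AlgebraicGeometry.HodgeTheory
open Literature.AlgebraicGeometry.Hyperkaehler Literature.AlgebraicGeometry.Surfaces
open Summit.HodgeConjecture.HodgeConjecture.Theorems.NikulinTwinTransport
open Summit.HodgeConjecture.HodgeConjecture.Theorems.MarkmanPartnerTransport.BBFPositivity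

namespace Summit.HodgeConjecture.HodgeConjecture.Theorems.MarkmanPartnerTransport.PartnerLattice

/-- `MarkedK3Sq[X, φ, P, z]`: VERBATIM the `let MarkedK3Sq := …` binder of the route declarations of
MarkmanPartnerTransport (clauses (m1)–(m6)). Local notation only. -/
local notation3 (prettyPrint := false) "MarkedK3Sq[" X ", " φ ", " P ", " z "]" =>
  (((IsIntegralClass P ∧ ∀ Q : complexBetti X (2 * 4), IsIntegralClass Q → ∃ n : ℤ, Q = n • P) ∧
    (∀ c : complexBetti X 2, IsIntegralClass c ↔ ∃ v : K3HilbertIndex → ℤ, φ c = fun i => (v i : ℂ)) ∧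
    (∀ a : complexBetti X 2, cupPowTwo a 4 = ((3 : ℂ) * (k3HilbertForm 2 (φ a) (φ a)) ^ 2) • P) ∧
    (IsOfHodgeType 4 X 2 2 0 (LinearEquiv.symm φ z) ∧
      ∀ τ : complexBetti X 2, IsOfHodgeType 4 X 2 2 0 τ → ∃ t : ℂ, τ = t • LinearEquiv.symm φ z) ∧
    (∀ c : complexBetti X 2, IsOfHodgeType 4 X 2 1 1 c ↔
      (k3HilbertForm 2 (φ c) z = 0 ∧ k3HilbertForm 2 (φ c) (star z) = 0)) ∧
    (k3HilbertForm 2 z z = 0 ∧ 0 < (k3HilbertForm 2 (star z) z).re)))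

/-! ### Coordinates -/

/-- The `K3^{[2]}` form of a vector with no `δ`-component against any vector is the K3 form of the
`Λ_{K3}`-parts. [cite: Beauville1983, §9 Lemme 1] -/
theorem k3HilbertForm_sumElim_zero_left (y : K3Index → ℂ) (v : K3HilbertIndex → ℂ) :
    k3HilbertForm 2 (Sum.elim y 0) v = k3Form y (fun k => v (Sum.inl k)) := by
  have hv : v = Sum.elim (fun k => v (Sum.inl k)) (fun u => v (Sum.inr u)) := by
    funext i; rcases i with k | u <;> rfl
  conv_lhs => rw [hv]
  simp [k3HilbertForm, k3Form, Fintype.sum_sum_type, k3HilbertGram_inl_inl, k3HilbertGram_inl_inr]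

variable {S : SchemeOver ℂ} {η : complexBetti S (2 * 1) ≃ₗ[ℂ] (K3Index → ℂ)} {p : complexBetti S (2 * 2)}
  {x : K3Index → ℂ} {H : SchemeOver ℂ} {φH : complexBetti H 2 ≃ₗ[ℂ] (K3HilbertIndex → ℂ)}
  {PH : complexBetti H (2 * 4)} {i : complexBetti S (2 * 1) →ₗ[ℂ] complexBetti H 2}

/-! ### The incidence `i` -/

/-- `i` is injective (`φ_H ∘ i = (η ·, 0)`). [cite: Beauville1983, §6 Prop. 6] -/
theorem incidence_injective (hi : ∀ a, φH (i a) = Sum.elim (η a) 0) : Function.Injective i := by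
  intro a b hab
  have h := congrArg φH hab
  rw [hi, hi] at h
  apply η.injective
  funext k
  simpa using congrFun h (Sum.inl k)

/-- `i` preserves rational classes. [cite: Beauville1983, §6 Prop. 6 and Remarque] -/
theorem isRationalClass_incidence (hS : IsK3Surface S) (hH : IsSmoothProjective 4 H)
    (hηint : ∀ c : complexBetti S (2 * 1), IsIntegralClass c ↔ ∃ v : K3Index → ℤ, η c = fun i => (v i : ℂ))
    (hintH : ∀ c : complexBetti H 2, IsIntegralClass c ↔ ∃ v : K3HilbertIndex → ℤ, φH c = fun i => (v i : ℂ))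
    (hi : ∀ a, φH (i a) = Sum.elim (η a) 0) {a : complexBetti S (2 * 1)} (ha : IsRationalClass a) :
    IsRationalClass (i a) := by
  obtain ⟨v, hv⟩ := (isRationalClass_iff_of_marking hS η hηint a).1 ha
  refine (isRationalClass_iff_of_markedSq hH hintH _).2 ⟨Sum.elim v 0, ?_⟩
  rw [hi, hv]
  funext k
  rcases k with k | k <;> simp

/-- `i` carries the `(2,0)`-class `η⁻¹ x` of `S` to the `(2,0)`-class `φ_H⁻¹(x, 0)` of `H`; hence
`(2,0)`-classes to `(2,0)`-classes. [cite: Beauville1983, §6 Prop. 6] -/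
theorem incidence_twoZero (hMH : MarkedK3Sq[H, φH, PH, Sum.elim x 0])
    (h20span : ∀ τ : complexBetti S (2 * 1), IsOfHodgeType 2 S (2 * 1) 2 0 τ → ∃ t : ℂ, τ = t • η.symm x)
    (hi : ∀ a, φH (i a) = Sum.elim (η a) 0) {a : complexBetti S (2 * 1)}
    (ha : IsOfHodgeType 2 S (2 * 1) 2 0 a) : IsOfHodgeType 4 H 2 2 0 (i a) := by
  obtain ⟨-, -, -, ⟨hzH20, -⟩, -⟩ := id hMH
  obtain ⟨t, rfl⟩ := h20span a ha
  have hix : i (η.symm x) = φH.symm (Sum.elim x 0) := by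
    apply φH.injective
    rw [hi, LinearEquiv.apply_symm_apply, LinearEquiv.apply_symm_apply]
  rw [map_smul, hix]
  exact hzH20.smul t

/-- `i` carries `(1,1)`-classes of `S` (`⊥ x, x̄`) to `(1,1)`-classes of `H` (`⊥ (x,0), (x̄,0)`).
[cite: Beauville1983, §6 Prop. 6] [cite: Huybrechts2016K3, Ch. 6 Prop. 1.2] -/
theorem incidence_oneOne (hS : IsK3Surface S) (hp0 : p ≠ 0)
    (hηint : ∀ c : complexBetti S (2 * 1), IsIntegralClass c ↔ ∃ v : K3Index → ℤ, η c = fun i => (v i : ℂ))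
    (hcupS : ∀ a b : complexBetti S (2 * 1),
      cupProduct (rfl : 2 * 1 + 2 * 1 = 2 * 2) a b = k3Form (η a) (η b) • p)
    (h20 : IsOfHodgeType 2 S (2 * 1) 2 0 (η.symm x)) (hxpos : 0 < (k3Form (star x) x).re)
    (hMH : MarkedK3Sq[H, φH, PH, Sum.elim x 0])
    (hi : ∀ a, φH (i a) = Sum.elim (η a) 0) {a : complexBetti S (2 * 1)}
    (ha : IsOfHodgeType 2 S (2 * 1) 1 1 a) : IsOfHodgeType 4 H 2 1 1 (i a) := by
  obtain ⟨-, -, -, -, h11H, -⟩ := id hMH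
  obtain ⟨hax, haxbar⟩ := (oneOne_iff_of_marking hS hp0 hηint hcupS h20 hxpos a).1 ha
  -- `\overline{(x, 0)} = (x̄, 0)` (landed copies sit in other routes' theses cones — not imported)
  have hstar : star (Sum.elim x (0 : Unit → ℂ)) = Sum.elim (star x) 0 := by
    funext k; rcases k with k | k <;> simp
  refine (h11H _).2 ⟨?_, ?_⟩
  · rw [hi, k3HilbertForm_inl]; exact hax
  · rw [hi, hstar, k3HilbertForm_inl]; exact haxbar

/-! ### The retraction `π = η⁻¹ ∘ pr ∘ φ_H` -/

/-- `π (i a) = a`. [cite: Beauville1983, §6 Prop. 6] -/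
theorem retraction_incidence (hi : ∀ a, φH (i a) = Sum.elim (η a) 0) (a : complexBetti S (2 * 1)) :
    η.symm (fun k => φH (i a) (Sum.inl k)) = a := by
  apply η.injective
  rw [LinearEquiv.apply_symm_apply, hi]
  rfl

/-- `π` preserves rational classes. [cite: Beauville1983, §6 Prop. 6 and Remarque] -/
theorem isRationalClass_retraction (hS : IsK3Surface S) (hH : IsSmoothProjective 4 H)
    (hηint : ∀ c : complexBetti S (2 * 1), IsIntegralClass c ↔ ∃ v : K3Index → ℤ, η c = fun i => (v i : ℂ))
    (hintH : ∀ c : complexBetti H 2, IsIntegralClass c ↔ ∃ v : K3HilbertIndex → ℤ, φH c = fun i => (v i : ℂ))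
    {w : complexBetti H 2} (hw : IsRationalClass w) :
    IsRationalClass (η.symm (fun k => φH w (Sum.inl k))) := by
  obtain ⟨n, hn⟩ := (isRationalClass_iff_of_markedSq hH hintH w).1 hw
  exact (isRationalClass_iff_of_marking hS η hηint _).2
    ⟨fun k => n (Sum.inl k), by rw [LinearEquiv.apply_symm_apply, hn]⟩

/-- `π` carries `(2,0)`-classes of `H` (multiples of `φ_H⁻¹(x,0)`) to `(2,0)`-classes of `S`.
[cite: Beauville1983, §6 Prop. 6] -/
theorem retraction_twoZero (hMH : MarkedK3Sq[H, φH, PH, Sum.elim x 0])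
    (h20 : IsOfHodgeType 2 S (2 * 1) 2 0 (η.symm x)) {w : complexBetti H 2}
    (hw : IsOfHodgeType 4 H 2 2 0 w) : IsOfHodgeType 2 S (2 * 1) 2 0 (η.symm (fun k => φH w (Sum.inl k))) := by
  obtain ⟨-, -, -, ⟨-, hzH20span⟩, -⟩ := id hMH
  obtain ⟨t, rfl⟩ := hzH20span w hw
  have h : (fun k => φH (t • φH.symm (Sum.elim x 0)) (Sum.inl k)) = t • x := by
    rw [map_smul, LinearEquiv.apply_symm_apply]
    funext k
    simp
  rw [h, map_smul]
  exact h20.smul t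

/-- `π` carries `(1,1)`-classes of `H` to `(1,1)`-classes of `S`. [cite: Beauville1983, §6 Prop. 6]
[cite: Huybrechts2016K3, Ch. 6 Prop. 1.2] -/
theorem retraction_oneOne (hS : IsK3Surface S) (hp0 : p ≠ 0)
    (hηint : ∀ c : complexBetti S (2 * 1), IsIntegralClass c ↔ ∃ v : K3Index → ℤ, η c = fun i => (v i : ℂ))
    (hcupS : ∀ a b : complexBetti S (2 * 1),
      cupProduct (rfl : 2 * 1 + 2 * 1 = 2 * 2) a b = k3Form (η a) (η b) • p)
    (h20 : IsOfHodgeType 2 S (2 * 1) 2 0 (η.symm x)) (hxpos : 0 < (k3Form (star x) x).re)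
    (hMH : MarkedK3Sq[H, φH, PH, Sum.elim x 0]) {w : complexBetti H 2} (hw : IsOfHodgeType 4 H 2 1 1 w) :
    IsOfHodgeType 2 S (2 * 1) 1 1 (η.symm (fun k => φH w (Sum.inl k))) := by
  obtain ⟨-, -, -, -, h11H, -⟩ := id hMH
  obtain ⟨hw1, hw2⟩ := (h11H w).1 hw
  have hstar : star (Sum.elim x (0 : Unit → ℂ)) = Sum.elim (star x) 0 := by
    funext k; rcases k with k | k <;> simp
  refine (oneOne_iff_of_marking hS hp0 hηint hcupS h20 hxpos _).2 ⟨?_, ?_⟩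
  · rw [LinearEquiv.apply_symm_apply, ← k3HilbertForm_sumElim_zero_right]
    exact hw1
  · rw [LinearEquiv.apply_symm_apply, ← k3HilbertForm_sumElim_zero_right, ← hstar]
    exact hw2

/-- **`π` maps `N¹(H)` into `N¹(S)`** (rational algebraic classes of `H` are `(1,1)`, go to rational
`(1,1)`-classes of `S`, which are algebraic by Lefschetz `(1,1)`). [cite: VoisinHodgeI2002, Thm. 11.30]
[cite: Beauville1983, §6 Prop. 6 and Remarque] -/
theorem retraction_mem_algebraicClasses (hS : IsK3Surface S) (hp0 : p ≠ 0)
    (hηint : ∀ c : complexBetti S (2 * 1), IsIntegralClass c ↔ ∃ v : K3Index → ℤ, η c = fun i => (v i : ℂ))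
    (hcupS : ∀ a b : complexBetti S (2 * 1),
      cupProduct (rfl : 2 * 1 + 2 * 1 = 2 * 2) a b = k3Form (η a) (η b) • p)
    (h20 : IsOfHodgeType 2 S (2 * 1) 2 0 (η.symm x)) (hxpos : 0 < (k3Form (star x) x).re)
    (hH : IsSmoothProjective 4 H) (hMH : MarkedK3Sq[H, φH, PH, Sum.elim x 0])
    {w : complexBetti H 2} (hw : w ∈ algebraicClasses H 1) :
    η.symm (fun k => φH w (Sum.inl k)) ∈ algebraicClasses S 1 := by
  obtain ⟨-, hintH, -⟩ := id hMH
  have hS2 : IsSmoothProjective 2 S := IsK3Surface.isSmoothProjective hS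
  set Pr : complexBetti H 2 →ₗ[ℂ] complexBetti S (2 * 1) :=
    (η.symm : (K3Index → ℂ) →ₗ[ℂ] complexBetti S (2 * 1)) ∘ₗ
      LinearMap.funLeft ℂ ℂ (Sum.inl : K3Index → K3HilbertIndex) ∘ₗ
      (φH : complexBetti H 2 →ₗ[ℂ] (K3HilbertIndex → ℂ)) with hPrdef
  have hPr : ∀ w, Pr w = η.symm (fun k => φH w (Sum.inl k)) := fun w => rfl
  have hspan := supportedClasses_eq_span_isRationalClass hH 2 1
  change algebraicClasses H 1 = Submodule.span ℂ
    {c : complexBetti H 2 | IsRationalClass c ∧ c ∈ algebraicClasses H 1} at hspan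
  rw [← hPr, ← Submodule.mem_comap]
  rw [hspan] at hw
  refine (Submodule.span_le.2 ?_) hw
  rintro c ⟨hcrat, hcalg⟩
  rw [SetLike.mem_coe, Submodule.mem_comap, hPr]
  exact lefschetzOneOne_rational_holds hS2 _ (isRationalClass_retraction hS hH hηint hintH hcrat)
    (retraction_oneOne hS hp0 hηint hcupS h20 hxpos hMH
      (isOfHodgeType_of_mem_algebraicClasses_of_isSmoothProjective hH 1 hcalg))

/-! ### `i(T(S)) ⊆ T(H)` -/

/-- **`i` carries cup-transcendental classes of `S` to `q`-transcendental classes of `H`**: for `w ∈ N¹(H)`,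
`q(φ_H(i t), φ_H w) = (η t · η(π w))` and `π w ∈ N¹(S)`. [cite: Beauville1983, §6 Prop. 6, §9 Lemme 1]
[cite: Huybrechts2016K3, Ch. 3 Def. 2.5] -/
theorem incidence_bbfTransc (hS : IsK3Surface S) (hp0 : p ≠ 0)
    (hηint : ∀ c : complexBetti S (2 * 1), IsIntegralClass c ↔ ∃ v : K3Index → ℤ, η c = fun i => (v i : ℂ))
    (hcupS : ∀ a b : complexBetti S (2 * 1),
      cupProduct (rfl : 2 * 1 + 2 * 1 = 2 * 2) a b = k3Form (η a) (η b) • p)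
    (h20 : IsOfHodgeType 2 S (2 * 1) 2 0 (η.symm x)) (hxpos : 0 < (k3Form (star x) x).re)
    (hH : IsSmoothProjective 4 H) (hMH : MarkedK3Sq[H, φH, PH, Sum.elim x 0])
    (hi : ∀ a, φH (i a) = Sum.elim (η a) 0) {t : complexBetti S (2 * 1)}
    (ht : ∀ d ∈ algebraicClasses S 1, cupProduct (rfl : 2 * 1 + 2 * 1 = 2 * 2) t d = 0) :
    ∀ w ∈ algebraicClasses H 1, k3HilbertForm 2 (φH (i t)) (φH w) = 0 := by
  intro w hw
  have hd := retraction_mem_algebraicClasses hS hp0 hηint hcupS h20 hxpos hH hMH hw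
  have h0 := ht _ hd
  rw [hcupS, LinearEquiv.apply_symm_apply, smul_eq_zero] at h0
  rcases h0 with h0 | h0
  · rw [hi, k3HilbertForm_sumElim_zero_left]
    exact h0
  · exact absurd h0 hp0

end Summit.HodgeConjecture.HodgeConjecture.Theorems.MarkmanPartnerTransport.PartnerLattice

end
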